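/-
Copyright (c) 2026. All rights reserved.
Released under Apache 2.0 license as described in the file LICENSE.
Authors: abc-iut cell, wave-2 prover seat abc-iut-L5-t15.
-/
import Mathlib.FieldTheory.Perfect
import Mathlib.Algebra.CharP.Algebra
import Literature.IUT.LogVolume.DifferentEstimates
import Literature.IUT.LogVolume.FundamentalIdentity
import Literature.IUT.LogVolume.RelativeRamification
import HarnessLib

/-!
# The extension of valuation rings `𝒪_{k₀} ⊆ 𝒪_K` along an isometric embedding `k₀ → K`

Setting of [IUTchIV] Proposition 1.3 (Mochizuki, *Inter-universal Teichmüller theory IV*, RIMS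
manuscript (Apr. 2020), §1, kurims p. 11: "Suppose that `k_0 ⊆ k_i` is a subfield that contains
`ℚ_p`. Write `R_0 := 𝒪_{k_0}` … `e_0` for the ramification index of `k_0` over `ℚ_p`,
`e_{i/0} := e_i/e_0 (∈ ℤ)`"), in the cell's norm-side MLF class (`RamificationInvariants.lean`,
`IntegerRing.lean`, `DifferentEstimates.lean`): two fields `k₀`, `K` with `[NormedAlgebra k₀ K]`.
THEOREMS ONLY (no definition, no named fact); support file of the proof-only companion
`DifferentEstimatesProofs.lean`.

* `dvd_iff_norm_le`, `maximalIdeal_pow_dvd_span_singleton_iff`, `norm_irreducible_pow_eq`,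
  `neg_logb_norm_eq_div`, `norm_natCast_eq_rpow_neg`, `natCast_mem_maximalIdeal_iff` — the
  dictionary between divisibility / powers of `𝔪` in `𝒪_K` and norms `p^{-j/e}`.
* `finiteDimensional_rel`, `isSeparable_rel`, `charZero_base` — `K/k₀` is finite separable.
* Over abc-iut-S1's `RelativeRamification.lean` (the isometry `norm_algebraMap_eq`, `e₀ ∣ e`, and the
  SCOPED instances `Algebra 𝒪₀ 𝒪`, `IsScalarTower 𝒪₀ 𝒪 K`, `IsTorsionFree 𝒪₀ 𝒪` for
  `𝒪₀ = 𝒪_{k₀}`, `𝒪 = 𝒪_K`): the structure map is norm-preserving (`norm_algebraMap_relInt`) and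
  local (`isLocalHom_relInt`), `𝒪` is finite over `𝒪₀` (`moduleFinite_relInt`, via
  `ℤ_p ⊆ 𝒪₀ ⊆ 𝒪`), `𝔪 ∩ 𝒪₀ = 𝔪₀` (`comap_maximalIdeal_relInt`), and **`e' e₀ = e`,
  `𝔪₀ 𝒪 = 𝔪^{e'}`** for
  `e' = relRamificationIdx p k₀ K = e/e₀` (`relRamificationIdx_mul`, `map_maximalIdeal_relInt`) —
  the printed "`e_{i/0} := e_i/e_0 (∈ ℤ)`" and the fact that it IS the ramification index of `K/k₀`;
  `f₀ ∣ f` (`residueDegree_dvd`) and the fundamental identity **`e' · (f/f₀) = [K : k₀]`**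
  (`relRamificationIdx_mul_residueDegree_div`).

Classical (Serre, *Local Fields*, Ch. I §4, Ch. II §2); the [IUTchIV] locators record the cell's
typing, hence the claim-form tag on the transcribed quantities.
-/

noncomputable section

open Metric Set IsLocalRing Module
open scoped NormedField

namespace Literature.IUT.LogVolume

open Literature.NumberTheory.GaloisRepresentations.Ultrametric (exists_norm_eq_pow_of_norm_le_one
  mem_maximalIdeal_iff_norm_lt_one finite_residueField)

variable (p : ℕ) [Fact p.Prime]
variable (k₀ : Type*) [NontriviallyNormedField k₀] [inst₀ : NormedAlgebra ℚ_[p] k₀]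
  [IsUltrametricDist k₀] [ProperSpace k₀]
variable (K : Type*) [NontriviallyNormedField K] [instK : NormedAlgebra ℚ_[p] K]
  [IsUltrametricDist K] [ProperSpace K]

/-! ## Norms and divisibility in `𝒪_K` -/

omit [ProperSpace K] in
/-- In `𝒪_K`: `x ∣ y ↔ ‖y‖ ≤ ‖x‖` (the ideal `(x)` is the closed ball of radius `‖x‖`).
[cite: SerreLocalFields1979, Ch. I §1] -/
theorem dvd_iff_norm_le (x y : Valued.integer K) : x ∣ y ↔ ‖(y : K)‖ ≤ ‖(x : K)‖ := by
  rw [← Ideal.mem_span_singleton, ← SetLike.mem_coe,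
    Valued.integer.coe_span_singleton_eq_closedBall, mem_closedBall, dist_zero_right]
  rfl

/-- `𝔪^n ∣ (x) ↔ ‖x‖ ≤ ‖ϖ‖^n` for an irreducible `ϖ` of `𝒪_K`.
[cite: SerreLocalFields1979, Ch. I §1] -/
theorem maximalIdeal_pow_dvd_span_singleton_iff {ϖ : Valued.integer K}
    (hϖ : Irreducible ϖ) (x : Valued.integer K) (n : ℕ) :
    maximalIdeal (Valued.integer K) ^ n ∣ Ideal.span {x} ↔ ‖(x : K)‖ ≤ ‖(ϖ : K)‖ ^ n := by
  rw [hϖ.maximalIdeal_eq, Ideal.span_singleton_pow, Ideal.span_singleton_dvd_span_singleton_iff_dvd,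
    dvd_iff_norm_le]
  push_cast
  rw [norm_pow]

/-- `‖ϖ‖^j = p^{-j/e}` for an irreducible `ϖ` of `𝒪_K`. [claim: Mochizuki2012, status: disputed] -/
theorem norm_irreducible_pow_eq {ϖ : Valued.integer K} (hϖ : Irreducible ϖ)
    (j : ℕ) : ‖(ϖ : K)‖ ^ j = (p : ℝ) ^ (-((j : ℝ) / absRamificationIdx p K)) := by
  have hp0 : (0 : ℝ) ≤ p := by positivity
  rw [norm_irreducible_eq p K hϖ, ← Real.rpow_natCast, ← Real.rpow_mul hp0]
  congr 1
  ring

/-- A nonzero `x ∈ 𝒪_K` has `ord(x) = -log_p ‖x‖ = j/e` where `‖x‖ = ‖ϖ‖^j`.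
[claim: Mochizuki2012, status: disputed] -/
theorem neg_logb_norm_eq_div {ϖ : Valued.integer K} (hϖ : Irreducible ϖ)
    {x : K} {j : ℕ} (hx : ‖x‖ = ‖(ϖ : K)‖ ^ j) :
    -Real.logb p ‖x‖ = (j : ℝ) / absRamificationIdx p K := by
  have hp1 : (1 : ℝ) < p := by exact_mod_cast (Fact.out : p.Prime).one_lt
  have hp0 : (0 : ℝ) < p := by positivity
  rw [hx, norm_irreducible_pow_eq p K hϖ, Real.logb_rpow hp0 hp1.ne', neg_neg]

omit [IsUltrametricDist K] [ProperSpace K] in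
/-- `‖n‖_K = p^{-v_p(n)}` for a natural number `n ≠ 0`. [claim: Mochizuki2012, status: disputed] -/
theorem norm_natCast_eq_rpow_neg {n : ℕ} (hn : n ≠ 0) :
    ‖(n : K)‖ = (p : ℝ) ^ (-(padicValNat p n : ℝ)) := by
  rw [norm_natCast_eq_padicNorm p K n, Padic.norm_eq_zpow_neg_valuation (by exact_mod_cast hn),
    Padic.valuation_natCast, ← Real.rpow_intCast]
  congr 1
  simp only [Int.cast_neg, Int.cast_natCast]

/-- `(n : 𝒪_K) ∈ 𝔪_K ↔ p ∣ n` for a natural number `n`. [claim: Mochizuki2012, status: disputed] -/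
theorem natCast_mem_maximalIdeal_iff (n : ℕ) :
    (n : Valued.integer K) ∈ maximalIdeal (Valued.integer K) ↔ p ∣ n := by
  rw [mem_maximalIdeal_iff_norm_lt_one]
  change ‖((n : Valued.integer K) : K)‖ < 1 ↔ _
  rw [SubringClass.coe_natCast, norm_natCast_eq_padicNorm p K n]
  exact Padic.norm_natCast_lt_one_iff

omit instK [ProperSpace K] in
/-- `𝒪_K` has characteristic zero when `K` has. [claim: Mochizuki2012, status: disputed] -/
theorem charZero_integer [CharZero K] : CharZero (Valued.integer K) :=
  (algebraMap (Valued.integer K) K).charZero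

/-! ## The isometric embedding `k₀ → K` and the extension `𝒪_{k₀} ⊆ 𝒪_K` -/

variable [instA : NormedAlgebra k₀ K]

omit instA [IsUltrametricDist k₀] [ProperSpace k₀] in
include inst₀ in
/-- `k₀` has characteristic zero (it contains `ℚ_p`). [claim: Mochizuki2012, status: disputed] -/
theorem charZero_base : CharZero k₀ :=
  charZero_of_injective_algebraMap (algebraMap ℚ_[p] k₀).injective

omit [IsUltrametricDist k₀] [ProperSpace k₀] in
/-- `K` is finite-dimensional over `k₀` (it is so over `ℚ_p`).
[claim: Mochizuki2012, status: disputed] -/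
theorem finiteDimensional_rel [IsScalarTower ℚ_[p] k₀ K] :
    FiniteDimensional k₀ K := by
  haveI := finiteDimensional p K
  exact Module.Finite.of_restrictScalars_finite ℚ_[p] k₀ K

omit [IsUltrametricDist k₀] [ProperSpace k₀] in
/-- `K/k₀` is separable (characteristic zero). [claim: Mochizuki2012, status: disputed] -/
theorem isSeparable_rel [IsScalarTower ℚ_[p] k₀ K] : Algebra.IsSeparable k₀ K := by
  haveI := finiteDimensional_rel p k₀ K
  haveI := charZero_base p k₀
  haveI : Algebra.IsAlgebraic k₀ K := Algebra.IsAlgebraic.of_finite k₀ K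
  infer_instance

section RelInt

/-! ### The extension of valuation rings `𝒪₀ → 𝒪` induced by `k₀ → K`

The algebra structure `𝒪₀ → 𝒪` is abc-iut-S1's scoped instance `algebraInteger` of
`RelativeRamification.lean` (the restriction of `algebraMap k₀ K`). -/

omit inst₀ instK [ProperSpace k₀] [ProperSpace K] in
/-- On elements, `𝒪₀ → 𝒪` is `k₀ → K`. [claim: Mochizuki2012, status: disputed] -/
theorem coe_algebraMap_relInt (x : Valued.integer k₀) :
    ((algebraMap (Valued.integer k₀) (Valued.integer K) x : Valued.integer K) : K) =
      algebraMap k₀ K (x : k₀) := rfl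

omit inst₀ instK [ProperSpace k₀] [ProperSpace K] in
/-- `𝒪₀ → 𝒪` preserves norms. [claim: Mochizuki2012, status: disputed] -/
theorem norm_algebraMap_relInt (x : Valued.integer k₀) :
    ‖((algebraMap (Valued.integer k₀) (Valued.integer K) x : Valued.integer K) : K)‖ =
      ‖(x : k₀)‖ := by
  rw [coe_algebraMap_relInt, norm_algebraMap_eq]

omit [ProperSpace k₀] in
/-- `𝒪` is a finite `𝒪₀`-module. [claim: Mochizuki2012, status: disputed] -/
theorem moduleFinite_relInt [IsScalarTower ℚ_[p] k₀ K] :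
    Module.Finite (Valued.integer k₀) (Valued.integer K) := by
  haveI := isScalarTower_padicInt_integer p k₀ K
  exact Module.Finite.of_restrictScalars_finite ℤ_[p] (Valued.integer k₀) (Valued.integer K)

omit inst₀ instK in
/-- `𝔪 ∩ 𝒪₀ = 𝔪₀`. [claim: Mochizuki2012, status: disputed] -/
theorem comap_maximalIdeal_relInt :
    (maximalIdeal (Valued.integer K)).comap (algebraMap (Valued.integer k₀) (Valued.integer K)) =
      maximalIdeal (Valued.integer k₀) := by
  ext x
  rw [Ideal.mem_comap, mem_maximalIdeal_iff_norm_lt_one, mem_maximalIdeal_iff_norm_lt_one]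
  change ‖((algebraMap _ _ x : Valued.integer K) : K)‖ < 1 ↔ ‖(x : k₀)‖ < 1
  rw [norm_algebraMap_relInt]

omit inst₀ instK in
/-- `𝔪` lies over `𝔪₀`. [claim: Mochizuki2012, status: disputed] -/
theorem liesOver_maximalIdeal_relInt :
    (maximalIdeal (Valued.integer K)).LiesOver (maximalIdeal (Valued.integer k₀)) :=
  ⟨(comap_maximalIdeal_relInt k₀ K).symm⟩

/-- **`e₀ ∣ e` and `𝔪₀ 𝒪 = 𝔪^{e/e₀}`**: the image of a uniformizer `ϖ₀` of `k₀` has norm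
`p^{-1/e₀} = ‖ϖ‖^m`, so `m e₀ = e` and `ϖ₀ 𝒪 = 𝔪^m`. [claim: Mochizuki2012, status: disputed] -/
theorem exists_map_maximalIdeal_relInt :
    ∃ m : ℕ, m * absRamificationIdx p k₀ = absRamificationIdx p K ∧
      (maximalIdeal (Valued.integer k₀)).map (algebraMap (Valued.integer k₀) (Valued.integer K)) =
        maximalIdeal (Valued.integer K) ^ m := by
  obtain ⟨ϖ₀, h₀⟩ := IsDiscreteValuationRing.exists_irreducible (Valued.integer k₀)
  obtain ⟨ϖ, hϖ⟩ := IsDiscreteValuationRing.exists_irreducible (Valued.integer K)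
  set y : Valued.integer K := algebraMap (Valued.integer k₀) (Valued.integer K) ϖ₀ with hy
  have hy_norm : ‖(y : K)‖ = ‖(ϖ₀ : k₀)‖ := norm_algebraMap_relInt k₀ K ϖ₀
  have hy0' : (y : K) ≠ 0 := by
    rw [← norm_pos_iff, hy_norm, norm_pos_iff]
    exact fun h ↦ h₀.ne_zero (Subtype.ext h)
  have hy0 : y ≠ 0 := fun h ↦ hy0' (by rw [h]; rfl)
  obtain ⟨m, hm⟩ :=
    exists_norm_eq_pow_of_norm_le_one hϖ (y : K) hy0' (Valued.integer.norm_le_one y)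
  refine ⟨m, ?_, ?_⟩
  · have hp1 : (1 : ℝ) < p := by exact_mod_cast (Fact.out : p.Prime).one_lt
    have hp0 : (0 : ℝ) < p := by positivity
    have he₀ := absRamificationIdx_pos p k₀
    have he := absRamificationIdx_pos p K
    have h1 : (p : ℝ) ^ (-(1 / (absRamificationIdx p k₀ : ℝ))) =
        (p : ℝ) ^ (-((m : ℝ) / absRamificationIdx p K)) := by
      rw [← norm_irreducible_eq p k₀ h₀, ← hy_norm, hm, norm_irreducible_pow_eq p K hϖ]
    have h2 := congrArg (Real.logb p) h1
    rw [Real.logb_rpow hp0 hp1.ne', Real.logb_rpow hp0 hp1.ne', neg_inj] at h2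
    have h3 : (absRamificationIdx p K : ℝ) = m * absRamificationIdx p k₀ := by
      have he₀' : (absRamificationIdx p k₀ : ℝ) ≠ 0 := by exact_mod_cast he₀.ne'
      have he' : (absRamificationIdx p K : ℝ) ≠ 0 := by exact_mod_cast he.ne'
      field_simp at h2
      linarith
    exact_mod_cast h3.symm
  · rw [h₀.maximalIdeal_eq, Ideal.map_span, Set.image_singleton, ← hy]
    exact span_singleton_eq_maximalIdeal_pow K hϖ hy0 hm

/-- **`e' · e₀ = e`** for `e' = relRamificationIdx p k₀ K = e/e₀`.
[claim: Mochizuki2012, status: disputed] -/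
theorem relRamificationIdx_mul :
    relRamificationIdx p k₀ K * absRamificationIdx p k₀ = absRamificationIdx p K := by
  obtain ⟨m, hm, -⟩ := exists_map_maximalIdeal_relInt p k₀ K
  rw [relRamificationIdx, ← hm, Nat.mul_div_cancel _ (absRamificationIdx_pos p k₀)]

/-- `e' ≥ 1`. [claim: Mochizuki2012, status: disputed] -/
theorem relRamificationIdx_pos :
    0 < relRamificationIdx p k₀ K := by
  have h := relRamificationIdx_mul p k₀ K
  have he := absRamificationIdx_pos p K
  rcases Nat.eq_zero_or_pos (relRamificationIdx p k₀ K) with h0 | h0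
  · rw [h0, zero_mul] at h; omega
  · exact h0

/-- **`𝔪₀ 𝒪 = 𝔪^{e'}`**: `e' = e/e₀` is the ramification index of `K/k₀`.
[claim: Mochizuki2012, status: disputed] -/
theorem map_maximalIdeal_relInt :
    (maximalIdeal (Valued.integer k₀)).map (algebraMap (Valued.integer k₀) (Valued.integer K)) =
      maximalIdeal (Valued.integer K) ^ relRamificationIdx p k₀ K := by
  obtain ⟨m, hm, hmap⟩ := exists_map_maximalIdeal_relInt p k₀ K
  have : relRamificationIdx p k₀ K = m := by
    rw [relRamificationIdx, ← hm, Nat.mul_div_cancel _ (absRamificationIdx_pos p k₀)]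
  rw [this, hmap]

/-- `𝔪^{e'}` lies over `𝔪₀`. [claim: Mochizuki2012, status: disputed] -/
theorem liesOver_maximalIdeal_pow_relInt :
    (maximalIdeal (Valued.integer K) ^ relRamificationIdx p k₀ K).LiesOver
      (maximalIdeal (Valued.integer k₀)) := by
  refine ⟨(IsLocalRing.maximalIdeal.isMaximal (Valued.integer k₀)).eq_of_le ?_ ?_⟩
  · refine Ideal.comap_ne_top _ (ne_top_of_le_ne_top ?_
      (Ideal.pow_le_self (relRamificationIdx_pos p k₀ K).ne'))
    exact (IsLocalRing.maximalIdeal.isMaximal (Valued.integer K)).ne_top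
  · rw [Ideal.under_def, ← map_maximalIdeal_relInt p k₀ K]
    exact Ideal.le_comap_map

omit inst₀ instK [ProperSpace k₀] [ProperSpace K] in
/-- `𝒪₀ → 𝒪` is a local homomorphism (it preserves norms).
[claim: Mochizuki2012, status: disputed] -/
theorem isLocalHom_relInt : IsLocalHom (algebraMap (Valued.integer k₀) (Valued.integer K)) := by
  refine ⟨fun x hx ↦ ?_⟩
  rw [Valued.integer.isUnit_iff_norm_eq_one] at hx ⊢
  change ‖((algebraMap _ _ x : Valued.integer K) : K)‖ = 1 at hx
  rwa [norm_algebraMap_relInt] at hx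

/-- **`f₀ ∣ f`**: the residue field of `k₀` embeds in that of `K`, so `p^f = (p^{f₀})^{f'}`
(`f_i`, `f_0` the absolute residue degrees, [IUTchIV] Prop. 1.4, p. 13; Serre, Ch. I §4).
[claim: Mochizuki2012, status: disputed] -/
theorem residueDegree_dvd :
    residueDegree p k₀ ∣ residueDegree p K := by
  haveI := isLocalHom_relInt k₀ K
  letI := (IsLocalRing.ResidueField.map
    (algebraMap (Valued.integer k₀) (Valued.integer K))).toAlgebra
  haveI : Finite (ResidueField (Valued.integer K)) := finite_residueField
  haveI : Finite (ResidueField (Valued.integer k₀)) := finite_residueField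
  have hcard := Module.natCard_eq_pow_finrank (K := ResidueField (Valued.integer k₀))
    (V := ResidueField (Valued.integer K))
  rw [card_residueField p K, card_residueField p k₀, ← pow_mul] at hcard
  exact ⟨_, Nat.pow_right_injective (Fact.out : p.Prime).two_le hcard⟩

/-- **`e' · f' = [K : k₀]`** with `e' = e/e₀`, `f' = f/f₀`: the fundamental identity of the
extension `K/k₀` (from `e f = [K : ℚ_p]`, `e₀ f₀ = [k₀ : ℚ_p]` and the tower law; Serre, Ch. I §4 Prop. 10 /
Ch. II §2). [claim: Mochizuki2012, status: disputed] -/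
theorem relRamificationIdx_mul_residueDegree_div
    [IsScalarTower ℚ_[p] k₀ K] :
    relRamificationIdx p k₀ K * (residueDegree p K / residueDegree p k₀) = Module.finrank k₀ K := by
  obtain ⟨n, hn⟩ := residueDegree_dvd p k₀ K
  have hf₀ := residueDegree_pos p k₀
  have he₀ := absRamificationIdx_pos p k₀
  have hK := absRamificationIdx_mul_residueDegree p K
  have h₀ := absRamificationIdx_mul_residueDegree p k₀
  have he := relRamificationIdx_mul p k₀ K
  haveI := finiteDimensional p k₀
  haveI := finiteDimensional_rel p k₀ K
  have htower := Module.finrank_mul_finrank ℚ_[p] k₀ K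
  rw [hn, Nat.mul_div_cancel_left _ hf₀]
  have key : relRamificationIdx p k₀ K * n * (absRamificationIdx p k₀ * residueDegree p k₀) =
      Module.finrank k₀ K * (absRamificationIdx p k₀ * residueDegree p k₀) := by
    calc relRamificationIdx p k₀ K * n * (absRamificationIdx p k₀ * residueDegree p k₀)
        = (relRamificationIdx p k₀ K * absRamificationIdx p k₀) * (residueDegree p k₀ * n) := by
          ring
      _ = Module.finrank ℚ_[p] K := by rw [he, ← hn, hK]
      _ = Module.finrank k₀ K * (absRamificationIdx p k₀ * residueDegree p k₀) := by
          rw [h₀, ← htower]; ring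
  exact Nat.eq_of_mul_eq_mul_right (Nat.mul_pos he₀ hf₀) key

end RelInt

end Literature.IUT.LogVolume

end
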